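import Summits.ValiantsHypothesis.ValiantsHypothesis.Theorems.KPlusLogSqLawTridiagonalRealStaticDoubling
import Summits.ValiantsHypothesis.ValiantsHypothesis.Theorems.KPlusLogSqLawTridiagonalRealStaticRowStep

/-!
# Route «KPlusLogSqLaw», crux `WeakLifting` (stmt-ValiantsHypothesis-19561) — REAL side of the tridiagonal sector:
# the JOIN LAW — gluing a design to its mirror image THROUGH A MIDDLE VERTEX adds the certified rows (`B(2m+1) ≥ Z(D_m) + Z(D⁺_{m+1})`, all sizes)

HONEST FRAMING.  Helper (`--supports stmt-ValiantsHypothesis-19561 --as helper`), seat val-sym-lift-p3 (g14), cell `pub-symmetroid`, 2026-08-28,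
α register (static definite symmetric tridiagonal monomial designs), LOWER side; the odd-size companion of the doubling law
`…TridiagonalRealStaticDoubling` (g13) and the all-sizes form of the mechanism behind the seat's row `…TridiagonalRealStaticElevenSixteen`
(`D₁₁ = P · (A X^N P − 2 S)`, 7 + 9 = 16 at m = 11).  In the continuant currency `pathDet a d b f` of `…TridiagonalRealStaticPotentialDefs`
(block = vertices `0..n`, `N = D_{n+1}` its determinant, `N⁻ = D_n` the block minus its last vertex):
* `pathDet_extend` — the END EXTENSION of the block by one vertex `α X^e` linked to the vertex `n` by `β' X^φ` has determinant
  `α X^e · N − β'² X^{2φ} · N⁻` (three-term recurrence);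
* `pathDet_join` — the JOIN design of size `2n + 3`, `[block | β X^φ | middle vertex α X^e | β X^φ | mirror block]`, has determinant
  `N · (α X^e · N − 2 β² X^{2φ} · N⁻)`: by the two-sided splitting along the left coupling edge (`StaticTridiagonalRealCut.pathDet_split_two_sided`)
  and REVERSAL INVARIANCE (`StaticTridiagonalRealDoubling.pathDet_reverse`) the two cofactors across the middle vertex coincide, so the
  determinant FACTORISES as `N` times the determinant of the end extension with link `√2·β`;
* `card_posRoots_mul_of_disjoint` — distinct positive roots of a product of two nonzero real polynomials without common positive root add up;
* `card_posRoots_join` — EXACT ADDITIVITY: with nonzero links and `β ≠ 0`, consecutive continuants share no positive zero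
  (`eval_pathDet_succ_ne_zero`), so `N` and the second factor have no common positive zero and
  `#posRoots(join) = #posRoots(N) + #posRoots(α X^e N − 2β² X^{2φ} N⁻)`;
* `join_row` — THE JOIN LAW for certified rows: sign-alternation certificates with `Z₁ + 1` points for `N` and `Z₂ + 1` points for the second
  factor give at least `Z₁ + Z₂` distinct positive zeros of the join design;
* `join_row_step` — with the ROW STEP LAW (`StaticTridiagonalRealRowStep.row_step`, seed and switch): a certificate `l ++ [ρ]` for `N` plus one
  further point `σ > ρ` where `N` keeps its sign and agrees in sign with `N⁻` yields a join design of size `2n + 3` with at least `2|l| + 1` distinct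
  positive zeros — **`B(2m+1) ≥ 2Z + 1` from every certified `Z`-row of size `m` with an agreeing point** (`+2` instead of `+1` where the
  extension also harvests, as in the seat's sixteen at `m = 11`, is design-specific and not formalised here).
Nothing here is an upper bound; nothing bears on `WeakLifting` / `TropicalB` (stmt-19771) in their windows, Conjecture B, the Door-A registers,
`MatrixDescartes` (stmt-ValiantsHypothesis-18050) or VP ≠ VNP.
[mechanism: this seat's symmetric join (g13 memo SEED-AND-SWITCH-liftp3g13.md §3); folklore: continuants, reversal symmetry, intermediate values]
-/

-- `Summit.ValiantsHypothesis.ValiantsHypothesis.…` repeats a component by the D-0017 layout (single-conjunct summit); the name is mandated.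
set_option linter.dupNamespace false
set_option autoImplicit false

namespace Summit.ValiantsHypothesis.ValiantsHypothesis.Theorems.KPlusLogSqLaw.StaticTridiagonalRealJoin

open Polynomial
open Summit.ValiantsHypothesis.ValiantsHypothesis.Theorems.KPlusLogSqLaw.StaticTridiagonalRealPotential
  (pathDet pathDet_congr pathDet_add_two eval_pathDet_succ_ne_zero)
open Summit.ValiantsHypothesis.ValiantsHypothesis.Theorems.KPlusLogSqLaw.StaticTridiagonalRealCut (pathDet_split_two_sided)
open Summit.ValiantsHypothesis.ValiantsHypothesis.Theorems.KPlusLogSqLaw.StaticTridiagonalRealDoubling (pathDet_reverse)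
open Summit.ValiantsHypothesis.ValiantsHypothesis.Theorems.KPlusLogSqLaw.StaticTridiagonalRealLadder
  (le_card_posRoots_of_isChain ne_zero_of_isChain_alt)
open Summit.ValiantsHypothesis.ValiantsHypothesis.Theorems.KPlusLogSqLaw.StaticTridiagonalRealRowStep (row_step)

variable (a : ℕ → ℝ) (d : ℕ → ℕ) (b : ℕ → ℝ) (f : ℕ → ℕ)

/-! ### §1 The end extension and the join design: factorised determinants -/

/-- **End extension by one vertex.**  The block `(a, d, b, f)` of size `n + 1` extended by the vertex `n + 1` with diagonal entry `α X^e` and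
link `β' X^φ` to the vertex `n` has determinant `α X^e · D_{n+1} − β'² X^{2φ} · D_n`. [folklore: continuants] -/
theorem pathDet_extend (n : ℕ) (α : ℝ) (e : ℕ) (β' : ℝ) (φ : ℕ) :
    pathDet (fun t => if t = n + 1 then α else a t) (fun t => if t = n + 1 then e else d t)
        (fun t => if t = n then β' else b t) (fun t => if t = n then φ else f t) (n + 2) =
      C α * X ^ e * pathDet a d b f (n + 1) - C (β' ^ 2) * X ^ (2 * φ) * pathDet a d b f n := by
  rw [pathDet_add_two]
  have h1 : pathDet (fun t => if t = n + 1 then α else a t) (fun t => if t = n + 1 then e else d t)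
      (fun t => if t = n then β' else b t) (fun t => if t = n then φ else f t) (n + 1) = pathDet a d b f (n + 1) :=
    pathDet_congr (fun t ht => by rw [if_neg (by omega)]) (fun t ht => by rw [if_neg (by omega)])
      (fun t ht => by rw [if_neg (by omega)]) (fun t ht => by rw [if_neg (by omega)])
  have h0 : pathDet (fun t => if t = n + 1 then α else a t) (fun t => if t = n + 1 then e else d t)
      (fun t => if t = n then β' else b t) (fun t => if t = n then φ else f t) n = pathDet a d b f n :=
    pathDet_congr (fun t ht => by rw [if_neg (by omega)]) (fun t ht => by rw [if_neg (by omega)])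
      (fun t ht => by rw [if_neg (by omega)]) (fun t ht => by rw [if_neg (by omega)])
  rw [h1, h0, if_pos rfl, if_pos rfl, if_pos rfl, if_pos rfl, map_pow, mul_pow, ← pow_mul, mul_comm φ 2]

/-- **The join design factorises.**  Block `(a, d, b, f)` of size `n + 1` (vertices `0..n`), a middle vertex `n + 1` with diagonal entry `α X^e`,
and the MIRROR IMAGE of the block on the vertices `n+2..2n+2` (vertex `t` carries `a (2n+2−t), d (2n+2−t)`, link `t` carries
`b (2n+1−t), f (2n+1−t)`), the middle vertex being coupled to both neighbours by the same link `β X^φ`.  The determinant of this design of size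
`2n + 3` is `D_{n+1} · (α X^e · D_{n+1} − 2 β² X^{2φ} · D_n)`. [this seat: splitting + reversal] -/
theorem pathDet_join (n : ℕ) (α : ℝ) (e : ℕ) (β : ℝ) (φ : ℕ) :
    pathDet (fun t => if t ≤ n then a t else if t = n + 1 then α else a (2 * n + 2 - t))
        (fun t => if t ≤ n then d t else if t = n + 1 then e else d (2 * n + 2 - t))
        (fun t => if t < n then b t else if t ≤ n + 1 then β else b (2 * n + 1 - t))
        (fun t => if t < n then f t else if t ≤ n + 1 then φ else f (2 * n + 1 - t)) (2 * n + 3) =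
      pathDet a d b f (n + 1) *
        (C α * X ^ e * pathDet a d b f (n + 1) - C (2 * β ^ 2) * X ^ (2 * φ) * pathDet a d b f n) := by
  rw [show 2 * n + 3 = n + 2 + (n + 1) by ring, pathDet_split_two_sided]
  -- the left block and its leading minor
  have h1 : pathDet (fun t => if t ≤ n then a t else if t = n + 1 then α else a (2 * n + 2 - t))
      (fun t => if t ≤ n then d t else if t = n + 1 then e else d (2 * n + 2 - t))
      (fun t => if t < n then b t else if t ≤ n + 1 then β else b (2 * n + 1 - t))
      (fun t => if t < n then f t else if t ≤ n + 1 then φ else f (2 * n + 1 - t)) (n + 1) = pathDet a d b f (n + 1) :=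
    pathDet_congr (fun t ht => by rw [if_pos (by omega)]) (fun t ht => by rw [if_pos (by omega)])
      (fun t ht => by rw [if_pos (by omega)]) (fun t ht => by rw [if_pos (by omega)])
  have h0 : pathDet (fun t => if t ≤ n then a t else if t = n + 1 then α else a (2 * n + 2 - t))
      (fun t => if t ≤ n then d t else if t = n + 1 then e else d (2 * n + 2 - t))
      (fun t => if t < n then b t else if t ≤ n + 1 then β else b (2 * n + 1 - t))
      (fun t => if t < n then f t else if t ≤ n + 1 then φ else f (2 * n + 1 - t)) n = pathDet a d b f n :=
    pathDet_congr (fun t ht => by rw [if_pos (by omega)]) (fun t ht => by rw [if_pos (by omega)])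
      (fun t ht => by rw [if_pos (by omega)]) (fun t ht => by rw [if_pos (by omega)])
  -- middle vertex + mirror block = the end extension (link β) read backwards
  have h2 : pathDet (fun t => (fun t => if t ≤ n then a t else if t = n + 1 then α else a (2 * n + 2 - t)) (t + (n + 1)))
      (fun t => (fun t => if t ≤ n then d t else if t = n + 1 then e else d (2 * n + 2 - t)) (t + (n + 1)))
      (fun t => (fun t => if t < n then b t else if t ≤ n + 1 then β else b (2 * n + 1 - t)) (t + (n + 1)))
      (fun t => (fun t => if t < n then f t else if t ≤ n + 1 then φ else f (2 * n + 1 - t)) (t + (n + 1))) (n + 2) =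
      C α * X ^ e * pathDet a d b f (n + 1) - C (β ^ 2) * X ^ (2 * φ) * pathDet a d b f n := by
    rw [← pathDet_extend a d b f n α e β φ,
      ← pathDet_reverse (fun t => if t = n + 1 then α else a t) (fun t => if t = n + 1 then e else d t)
        (fun t => if t = n then β else b t) (fun t => if t = n then φ else f t) (n + 2)]
    refine pathDet_congr (fun t ht => ?_) (fun t ht => ?_) (fun t ht => ?_) (fun t ht => ?_)
    · simp only
      by_cases h0 : t = 0
      · subst h0; rw [if_neg (by omega), if_pos (by omega), if_pos (by omega)]
      · rw [if_neg (by omega), if_neg (by omega), if_neg (by omega), show 2 * n + 2 - (t + (n + 1)) = n + 2 - 1 - t by omega]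
    · simp only
      by_cases h0 : t = 0
      · subst h0; rw [if_neg (by omega), if_pos (by omega), if_pos (by omega)]
      · rw [if_neg (by omega), if_neg (by omega), if_neg (by omega), show 2 * n + 2 - (t + (n + 1)) = n + 2 - 1 - t by omega]
    · simp only
      by_cases h0 : t = 0
      · subst h0; rw [if_neg (by omega), if_pos (by omega), if_pos (by omega)]
      · rw [if_neg (by omega), if_neg (by omega), if_neg (by omega), show 2 * n + 1 - (t + (n + 1)) = n + 2 - 2 - t by omega]
    · simp only
      by_cases h0 : t = 0
      · subst h0; rw [if_neg (by omega), if_pos (by omega), if_pos (by omega)]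
      · rw [if_neg (by omega), if_neg (by omega), if_neg (by omega), show 2 * n + 1 - (t + (n + 1)) = n + 2 - 2 - t by omega]
  -- the mirror block = the block read backwards
  have h3 : pathDet (fun t => (fun t => if t ≤ n then a t else if t = n + 1 then α else a (2 * n + 2 - t)) (t + (n + 2)))
      (fun t => (fun t => if t ≤ n then d t else if t = n + 1 then e else d (2 * n + 2 - t)) (t + (n + 2)))
      (fun t => (fun t => if t < n then b t else if t ≤ n + 1 then β else b (2 * n + 1 - t)) (t + (n + 2)))
      (fun t => (fun t => if t < n then f t else if t ≤ n + 1 then φ else f (2 * n + 1 - t)) (t + (n + 2))) (n + 1) =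
      pathDet a d b f (n + 1) := by
    rw [← pathDet_reverse a d b f (n + 1)]
    refine pathDet_congr (fun t ht => ?_) (fun t ht => ?_) (fun t ht => ?_) (fun t ht => ?_)
    · simp only; rw [if_neg (by omega), if_neg (by omega), show 2 * n + 2 - (t + (n + 2)) = n + 1 - 1 - t by omega]
    · simp only; rw [if_neg (by omega), if_neg (by omega), show 2 * n + 2 - (t + (n + 2)) = n + 1 - 1 - t by omega]
    · simp only; rw [if_neg (by omega), if_neg (by omega), show 2 * n + 1 - (t + (n + 2)) = n + 1 - 2 - t by omega]
    · simp only; rw [if_neg (by omega), if_neg (by omega), show 2 * n + 1 - (t + (n + 2)) = n + 1 - 2 - t by omega]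
  rw [h1, h0, h2, h3,
    show (if n < n then b n else if n ≤ n + 1 then β else b (2 * n + 1 - n)) = β by simp,
    show (if n < n then f n else if n ≤ n + 1 then φ else f (2 * n + 1 - n)) = φ by simp,
    mul_pow, ← pow_mul, mul_comm φ 2]
  simp only [map_mul, map_pow, map_ofNat]
  ring

/-- The join determinant at a real point: `D_{n+1}(x) · (α x^e D_{n+1}(x) − 2 β² x^{2φ} D_n(x))`. [this seat] -/
theorem eval_pathDet_join (n : ℕ) (α : ℝ) (e : ℕ) (β : ℝ) (φ : ℕ) (x : ℝ) :
    (pathDet (fun t => if t ≤ n then a t else if t = n + 1 then α else a (2 * n + 2 - t))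
        (fun t => if t ≤ n then d t else if t = n + 1 then e else d (2 * n + 2 - t))
        (fun t => if t < n then b t else if t ≤ n + 1 then β else b (2 * n + 1 - t))
        (fun t => if t < n then f t else if t ≤ n + 1 then φ else f (2 * n + 1 - t)) (2 * n + 3)).eval x =
      (pathDet a d b f (n + 1)).eval x *
        (α * x ^ e * (pathDet a d b f (n + 1)).eval x - 2 * β ^ 2 * x ^ (2 * φ) * (pathDet a d b f n).eval x) := by
  rw [pathDet_join]
  simp only [eval_mul, eval_sub, eval_pow, eval_X, eval_C]

/-! ### §2 Counting: exact additivity of distinct positive roots -/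

/-- Distinct positive roots of a product of two nonzero real polynomials WITHOUT COMMON POSITIVE ROOT add up. [folklore] -/
theorem card_posRoots_mul_of_disjoint (P Q : ℝ[X]) (hPQ : P * Q ≠ 0) (hdis : ∀ r : ℝ, 0 < r → P.eval r = 0 → Q.eval r ≠ 0) :
    ((P * Q).roots.toFinset.filter (fun t => 0 < t)).card =
      (P.roots.toFinset.filter (fun t => 0 < t)).card + (Q.roots.toFinset.filter (fun t => 0 < t)).card := by
  have hP : P ≠ 0 := left_ne_zero_of_mul hPQ
  have hQ : Q ≠ 0 := right_ne_zero_of_mul hPQ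
  rw [roots_mul hPQ, Multiset.toFinset_add, Finset.filter_union]
  refine Finset.card_union_of_disjoint (Finset.disjoint_left.mpr fun r hrP hrQ => ?_)
  rw [Finset.mem_filter, Multiset.mem_toFinset, mem_roots hP] at hrP
  rw [Finset.mem_filter, Multiset.mem_toFinset, mem_roots hQ] at hrQ
  exact hdis r hrP.2 hrP.1 hrQ.1

/-- **EXACT ADDITIVITY FOR THE JOIN.**  If the links of the block are nonzero, `β ≠ 0`, and neither `N = D_{n+1}` nor the second factor
`E = α X^e · N − 2β² X^{2φ} · D_n` is the zero polynomial, then the join design has exactly `#posRoots(N) + #posRoots(E)` distinct positive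
determinant zeros: at a positive zero of `N` the factor `E` equals `−2β² x^{2φ} D_n(x) ≠ 0`, because consecutive continuants of a design with
nonzero links share no positive zero. [this seat] -/
theorem card_posRoots_join (hb : ∀ t, b t ≠ 0) (n : ℕ) (α : ℝ) (e : ℕ) {β : ℝ} (hβ : β ≠ 0) (φ : ℕ)
    (hN : pathDet a d b f (n + 1) ≠ 0)
    (hE : C α * X ^ e * pathDet a d b f (n + 1) - C (2 * β ^ 2) * X ^ (2 * φ) * pathDet a d b f n ≠ 0) :
    ((pathDet (fun t => if t ≤ n then a t else if t = n + 1 then α else a (2 * n + 2 - t))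
        (fun t => if t ≤ n then d t else if t = n + 1 then e else d (2 * n + 2 - t))
        (fun t => if t < n then b t else if t ≤ n + 1 then β else b (2 * n + 1 - t))
        (fun t => if t < n then f t else if t ≤ n + 1 then φ else f (2 * n + 1 - t)) (2 * n + 3)).roots.toFinset.filter
          (fun t => 0 < t)).card =
      ((pathDet a d b f (n + 1)).roots.toFinset.filter (fun t => 0 < t)).card +
        ((C α * X ^ e * pathDet a d b f (n + 1) - C (2 * β ^ 2) * X ^ (2 * φ) * pathDet a d b f n).roots.toFinset.filter
          (fun t => 0 < t)).card := by
  rw [pathDet_join]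
  refine card_posRoots_mul_of_disjoint _ _ (mul_ne_zero hN hE) fun r hr hNr hEr => ?_
  have hDn : (pathDet a d b f n).eval r ≠ 0 := fun h0 => eval_pathDet_succ_ne_zero a d b f hb hr n h0 hNr
  have hEr' : (C α * X ^ e * pathDet a d b f (n + 1) - C (2 * β ^ 2) * X ^ (2 * φ) * pathDet a d b f n).eval r =
      -(2 * β ^ 2 * r ^ (2 * φ) * (pathDet a d b f n).eval r) := by
    simp only [eval_sub, eval_mul, eval_C, eval_pow, eval_X, hNr]; ring
  rw [hEr', neg_eq_zero] at hEr
  exact mul_ne_zero (mul_ne_zero (mul_ne_zero two_ne_zero (pow_ne_zero _ hβ)) (pow_ne_zero _ hr.ne')) hDn hEr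

/-- A real polynomial that alternates in sign along a list with at least two points is not the zero polynomial. [bookkeeping] -/
theorem ne_zero_of_alternates (P : ℝ[X]) {L : List ℝ} (hL : 2 ≤ L.length)
    (halt : L.IsChain (fun x y => P.eval x * P.eval y < 0)) : P ≠ 0 := by
  match L, halt, hL with
  | [], _, hL => simp at hL
  | [_], _, hL => simp at hL
  | x :: y :: l, h, _ =>
    intro hP
    have hx := ne_zero_of_isChain_alt h x (by simp)
    rw [hP, eval_zero] at hx
    exact hx rfl

/-- **THE JOIN LAW (certified rows add up, all sizes).**  If the links of the block are nonzero, `β ≠ 0`, `N = D_{n+1}` alternates in sign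
along a strictly increasing list `L₁` of positive points and `E = α X^e · N − 2β² X^{2φ} · D_n` (the determinant of the end extension with link
`√2·β`, `pathDet_extend`) alternates along a strictly increasing list `L₂` of positive points (both lists with at least two points), then the join
design of size `2n + 3` has at least `(|L₁| − 1) + (|L₂| − 1)` distinct positive determinant zeros. [this seat] -/
theorem join_row (hb : ∀ t, b t ≠ 0) (n : ℕ) (α : ℝ) (e : ℕ) {β : ℝ} (hβ : β ≠ 0) (φ : ℕ)
    (L₁ L₂ : List ℝ) (h₁ : 2 ≤ L₁.length) (h₂ : 2 ≤ L₂.length)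
    (hlt₁ : L₁.IsChain (· < ·)) (hpos₁ : ∀ u ∈ L₁, 0 < u)
    (halt₁ : L₁.IsChain (fun x y => (pathDet a d b f (n + 1)).eval x * (pathDet a d b f (n + 1)).eval y < 0))
    (hlt₂ : L₂.IsChain (· < ·)) (hpos₂ : ∀ u ∈ L₂, 0 < u)
    (halt₂ : L₂.IsChain (fun x y =>
      (C α * X ^ e * pathDet a d b f (n + 1) - C (2 * β ^ 2) * X ^ (2 * φ) * pathDet a d b f n).eval x *
        (C α * X ^ e * pathDet a d b f (n + 1) - C (2 * β ^ 2) * X ^ (2 * φ) * pathDet a d b f n).eval y < 0)) :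
    (L₁.length - 1) + (L₂.length - 1) ≤
      ((pathDet (fun t => if t ≤ n then a t else if t = n + 1 then α else a (2 * n + 2 - t))
        (fun t => if t ≤ n then d t else if t = n + 1 then e else d (2 * n + 2 - t))
        (fun t => if t < n then b t else if t ≤ n + 1 then β else b (2 * n + 1 - t))
        (fun t => if t < n then f t else if t ≤ n + 1 then φ else f (2 * n + 1 - t)) (2 * n + 3)).roots.toFinset.filter
          (fun t => 0 < t)).card := by
  rw [card_posRoots_join a d b f hb n α e hβ φ (ne_zero_of_alternates _ h₁ halt₁) (ne_zero_of_alternates _ h₂ halt₂)]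
  exact Nat.add_le_add (le_card_posRoots_of_isChain _ L₁ hlt₁ hpos₁ halt₁) (le_card_posRoots_of_isChain _ L₂ hlt₂ hpos₂ halt₂)

/-! ### §3 The join of a row with its own one-vertex extension: `B(2m+1) ≥ 2Z + 1` -/

/-- **JOIN + ROW STEP (all sizes).**  Let the links of the block be nonzero and let `N = D_{n+1}` alternate in sign along the positive, strictly
increasing points `l ++ [ρ]` (`|l|` certified zeros); let `σ > ρ` be a further point with `N(ρ) · N(σ) > 0` and `N(σ) · D_n(σ) > 0`.  Then for
some exponent `F` and some coupling `β > 0` the join design `[block | β X^F | 1·X⁰ | β X^F | mirror block]` of size `2n + 3` has at least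
`2|l| + 1` distinct positive determinant zeros: `|l|` from the factor `N` and `|l| + 1` from the seed-and-switch extension
(`StaticTridiagonalRealRowStep.row_step` with link `√2·β`).  **`B(2m+1) ≥ 2Z + 1`.** [this seat] -/
theorem join_row_step (hb : ∀ t, b t ≠ 0) (n : ℕ) (l : List ℝ) (ρ σ : ℝ)
    (hchain : (l ++ ρ :: [σ]).IsChain (· < ·)) (hpos : ∀ x ∈ l ++ [ρ], 0 < x)
    (halt : (l ++ [ρ]).IsChain (fun x y => (pathDet a d b f (n + 1)).eval x * (pathDet a d b f (n + 1)).eval y < 0))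
    (hρσ : 0 < (pathDet a d b f (n + 1)).eval ρ * (pathDet a d b f (n + 1)).eval σ)
    (hagree : 0 < (pathDet a d b f (n + 1)).eval σ * (pathDet a d b f n).eval σ) :
    ∃ (F : ℕ) (β : ℝ), 0 < β ∧ 2 * l.length + 1 ≤
      ((pathDet (fun t => if t ≤ n then a t else if t = n + 1 then 1 else a (2 * n + 2 - t))
        (fun t => if t ≤ n then d t else if t = n + 1 then 0 else d (2 * n + 2 - t))
        (fun t => if t < n then b t else if t ≤ n + 1 then β else b (2 * n + 1 - t))
        (fun t => if t < n then f t else if t ≤ n + 1 then F else f (2 * n + 1 - t)) (2 * n + 3)).roots.toFinset.filter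
          (fun t => 0 < t)).card := by
  obtain ⟨F, β', hβ', hnew, -⟩ := row_step a d b f n l ρ σ hchain hpos halt hρσ hagree
  -- the coupling `β = β' / √2`, so that `2 β² = β'²`
  refine ⟨F, β' / Real.sqrt 2, div_pos hβ' (Real.sqrt_pos.mpr two_pos), ?_⟩
  have h2β : 2 * (β' / Real.sqrt 2) ^ 2 = β' ^ 2 := by
    rw [div_pow, Real.sq_sqrt (by norm_num : (0 : ℝ) ≤ 2)]; ring
  -- order and positivity facts
  have hsplit := List.isChain_split.mp hchain
  have hρσ' : ρ < σ := (List.isChain_cons_cons.mp hsplit.2).1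
  have hρpos : 0 < ρ := hpos ρ (by simp)
  have hposall : ∀ x ∈ l ++ ρ :: [σ], 0 < x := by
    intro x hx
    rcases List.mem_append.mp hx with h1 | h1
    · exact hpos x (List.mem_append_left _ h1)
    · simp only [List.mem_cons, List.not_mem_nil, or_false] at h1
      rcases h1 with rfl | rfl
      · exact hρpos
      · exact hρpos.trans hρσ'
  -- the extension's alternation, rewritten in the closed form `X⁰ · N − β'² X^{2F} · D_n`
  have hE : pathDet (fun t => if t = n + 1 then 1 else a t) (fun t => if t = n + 1 then 0 else d t)
      (fun t => if t = n then β' else b t) (fun t => if t = n then F else f t) (n + 2) =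
      C (1 : ℝ) * X ^ 0 * pathDet a d b f (n + 1) - C (2 * (β' / Real.sqrt 2) ^ 2) * X ^ (2 * F) * pathDet a d b f n := by
    rw [pathDet_extend, h2β]
  rw [hE] at hnew
  -- certificate for `N`: the list `l ++ [ρ]` has `|l| + 1` points; if `l = []` the factor `N` contributes nothing
  rcases Nat.lt_or_ge l.length 1 with hl | hl
  · -- `l = []`: only the extension counts (one zero from `[ρ, σ]`)
    have hl0 : l = [] := List.eq_nil_of_length_eq_zero (by omega)
    subst hl0
    simp only [List.nil_append, List.length_nil, mul_zero, zero_add] at hnew ⊢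
    have hNE := ne_zero_of_alternates _ (by simp) hnew
    have hN : pathDet a d b f (n + 1) ≠ 0 := fun h0 => by
      rw [h0, eval_zero, zero_mul] at hρσ; exact lt_irrefl _ hρσ
    rw [card_posRoots_join a d b f hb n 1 0 (ne_of_gt (div_pos hβ' (Real.sqrt_pos.mpr two_pos))) F hN hNE]
    have h2 := le_card_posRoots_of_isChain _ (ρ :: [σ]) hchain hposall hnew
    simp only [List.length_cons, List.length_nil] at h2
    omega
  · have h1 : 2 ≤ (l ++ [ρ]).length := by simp; omega
    have h2 : 2 ≤ (l ++ ρ :: [σ]).length := by simp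
    have hmain := join_row a d b f hb n 1 0 (ne_of_gt (div_pos hβ' (Real.sqrt_pos.mpr two_pos))) F (l ++ [ρ]) (l ++ ρ :: [σ])
      h1 h2 hsplit.1 hpos halt hchain hposall hnew
    simp only [List.length_append, List.length_cons, List.length_nil] at hmain
    omega

end Summit.ValiantsHypothesis.ValiantsHypothesis.Theorems.KPlusLogSqLaw.StaticTridiagonalRealJoin
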